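import Mathlib.NumberTheory.ModularForms.QExpansion
import Literature.NumberTheory.Automorphic.ModularLambda
import HarnessLib

/-!
# `λ/16 = q − 8q² + ⋯ ∈ q + q² ℤ⟦q⟧`: the `q`-expansion of the modular `λ`-function

Sequel of `Literature/NumberTheory/Automorphic/ModularLambda.lean`
(`modularLambda τ = θ₂(τ)⁴/θ₃(τ)⁴`). Calegari–Dimitrov–Tang's proof of the unbounded
denominators conjecture (F. Calegari, V. Dimitrov, Y. Tang, J. Amer. Math. Soc. **38** (2025),
arXiv:2109.09040) runs on the coordinate `x = λ/16` of `Y(2)`; §1 p. 3 of the source records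

> `λ(τ)/16 = q − 8q² + 44q³ − 192q⁴ + ⋯ ∈ q + q² ℤ⟦q⟧`, `q = e^{πiτ}`,

"where this `q` is a square root of the `q = exp(2πiτ)` in (1)", and §3 (proof of
Proposition 15, display after (xt)) uses exactly this membership
(`x ∈ q + q²ℤ⟦q⟧ ⇒ t := x^{1/N} ∈ q^{1/N} + q^{2/N} ℤ[1/N]⟦q^{1/N}⟧`, whose formal half is
`Literature.RingTheory.Binomial.exists_root_series_of_mem_X_add_X_sq`).

We PROVE it here (no new definitions, no named facts), in the language of Mathlib's
`UpperHalfPlane.qExpansion` at period `2` (`Periodic.qParam 2 τ = e^{πiτ}`, `qParam_two`):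

* `exists_qExpansion_modularLambda_div_sixteen_eq_map` — there is `L ∈ ℤ⟦X⟧` with
  `L = X − 8X² + ⋯` (`coeff 0 L = 0`, `coeff 1 L = 1`, `coeff 2 L = −8`) and
  `qExpansion 2 (λ/16) = L` (mapped to `ℂ⟦X⟧`);
* `hasSum_qExpansion_modularLambda_div_sixteen` — `λ(τ)/16 = Σₘ (qExpansion 2 (λ/16))ₘ qᵐ`
  on `ℍ`;
* **`exists_hasSum_modularLambda_div_sixteen`** — the display above:
  `λ(τ)/16 = Σₘ Lₘ e^{πimτ}` for `Im τ > 0` with `L ∈ X − 8X² + X³ℤ⟦X⟧`.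

## Proof

Not via the `η`-product (no Jacobi triple product in Mathlib) but from the theta series:
`θ₃ = Σ_{n∈ℤ} q^{n²} = 1 + 2q + 2q⁴ + ⋯ ∈ 1 + qℤ⟦q⟧` (`exists_hasSum_theta3_qParam_two`, from
Mathlib's `hasSum_nat_jacobiTheta`) and `θ₂ = e^{πiτ/4} θ(τ/2, τ)` with
`θ(τ/2, τ)/2 = Σ_{n ≥ 0} q^{n(n+1)} ∈ 1 + q²ℤ⟦q⟧` (`exists_hasSum_jacobiTheta₂_half_qParam_two`,
pairing `n` with `−1−n` in Mathlib's `hasSum_jacobiTheta₂_term`), so that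
`θ₂⁴/16 = q · (θ(τ/2,τ)/2)⁴` (`theta2_pow_four_div_sixteen`). All four functions `λ/16`, `θ₃`,
`θ(τ/2,τ)/2`, `e^{πiτ}` are `2`-periodic, holomorphic on `ℍ` and have limits at `i∞`, so Mathlib's
`hasSum_qExpansion` / `qExpansion_mul` apply to their restrictions to `ℍ`
(`hasSum_qExpansion_two`, `qExpansion_two_pow`); by uniqueness of `q`-expansions
(`qExpansion_coeff_eq_of_hasSum`, the bare-function form of Mathlib's
`qExpansion_coeff_unique`) the identity `(λ/16) · θ₃⁴ = e^{πiτ} (θ(τ/2,τ)/2)⁴` becomes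
`qExpansion 2 (λ/16) · A⁴ = X · C⁴` in `ℂ⟦X⟧` with `A, C ∈ 1 + Xℤ⟦X⟧`, whence
`qExpansion 2 (λ/16) = X C⁴ A⁻⁴ ∈ ℤ⟦X⟧`, and the first coefficients are read off from
`a₀ = 1, a₁ = 2, c₀ = 1, c₁ = 0`.

## References

* [CalegariDimitrovTang2025] F. Calegari, V. Dimitrov, Y. Tang, The unbounded denominators
  conjecture, J. Amer. Math. Soc. 38 (2025), 627–702; arXiv:2109.09040, §1 p. 3 (the display
  `λ/16 = q − 8q² + 44q³ − ⋯ ∈ q + q²ℤ⟦q⟧`) and §3, proof of Proposition 15.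
* E. T. Whittaker, G. N. Watson, *A Course of Modern Analysis*, 4th ed. (1927), §21.7
  (`λ = k² = θ₂⁴/θ₃⁴`), §21.11 (the theta series).
-/

noncomputable section

open Complex Real Filter Topology Function
open UpperHalfPlane hiding I
open scoped Real Topology Manifold

namespace Literature.NumberTheory.Automorphic

namespace ModularLambda

open Literature.NumberTheory.EllipticCurves.JacobiThetaNull

/-! ### The parameter `q = e^{πiτ}` -/

/-- Mathlib's `q`-parameter at period `2` is `e^{πiτ}`. [folklore] -/
theorem qParam_two (τ : ℂ) : Periodic.qParam 2 τ = cexp (π * I * τ) := by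
  rw [Periodic.qParam]
  congr 1
  push_cast
  ring

/-- `e^{πikτ} = qᵏ` with `q = Periodic.qParam 2 τ`. [folklore] -/
theorem exp_pi_I_natCast_mul (k : ℕ) (τ : ℂ) :
    cexp (π * I * (k : ℂ) * τ) = Periodic.qParam 2 τ ^ k := by
  rw [qParam_two, ← Complex.exp_nat_mul]
  congr 1
  ring

/-! ### Uniqueness of `q`-expansions (bare-function form of Mathlib's `qExpansion_coeff_unique`) -/

/-- If `f : ℍ → ℂ` has a cusp function analytic at `0` for the period `h` and is everywhere
the sum of `Σ cₘ 𝕢ₕ(τ)ᵐ`, then `cₘ` is the `m`-th coefficient of Mathlib's `qExpansion h f`.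
(Mathlib's `UpperHalfPlane.qExpansion_coeff_unique` is this statement for bundled `FunLike`
objects; the proof is the same.) [folklore] -/
theorem qExpansion_coeff_eq_of_hasSum {f : ℍ → ℂ} {h : ℝ} {c : ℕ → ℂ} (hh : 0 < h)
    (hfanalytic : AnalyticAt ℂ (cuspFunction h f) 0)
    (hf : ∀ τ : ℍ, HasSum (fun m ↦ c m • Periodic.qParam h τ ^ m) (f τ)) (m : ℕ) :
    (qExpansion h f).coeff m = c m := by
  have h1 := (hasFPowerSeriesOnBall_cuspFunction hh hfanalytic hf).hasFPowerSeriesAt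
  have h2 := hfanalytic.hasFPowerSeriesAt
  have h3 := congr_arg (FormalMultilinearSeries.coeff · m) (h2.eq_formalMultilinearSeries h1)
  simp only [FormalMultilinearSeries.coeff_ofScalars] at h3
  rw [qExpansion_coeff, ← h3, div_eq_mul_inv, mul_comm]

/-- `qExpansion h (f ^ n) = (qExpansion h f) ^ n` when the cusp function of `f` is analytic at
`0` (iterating Mathlib's `qExpansion_mul`). [folklore] -/
theorem qExpansion_pow {f : ℍ → ℂ} {h : ℝ} (hf : AnalyticAt ℂ (cuspFunction h f) 0) (n : ℕ) :
    qExpansion h (f ^ n) = qExpansion h f ^ n ∧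
      cuspFunction h (f ^ n) = cuspFunction h f ^ n := by
  induction n with
  | zero =>
    have h1 : cuspFunction h (1 : ℍ → ℂ) = 1 := by
      ext q
      rcases eq_or_ne q 0 with rfl | hq
      · simpa [cuspFunction, Periodic.cuspFunction] using! tendsto_const_nhds.limUnder_eq
      · simp [cuspFunction, Periodic.cuspFunction_eq_of_nonzero h _ hq]
    simp only [pow_zero]
    exact ⟨qExpansion_one h, h1⟩
  | succ n ih =>
    have han : AnalyticAt ℂ (cuspFunction h (f ^ n)) 0 := by
      rw [ih.2]
      exact hf.pow n
    refine ⟨?_, ?_⟩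
    · rw [pow_succ, pow_succ, qExpansion_mul han hf, ih.1]
    · rw [pow_succ, pow_succ, cuspFunction_mul han.continuousAt hf.continuousAt, ih.2]

/-! ### Restrictions to `ℍ` of `2`-periodic holomorphic functions with a limit at `i∞` -/

section Restrict

variable {g : ℂ → ℂ}

/-- The restriction to `ℍ` of a function with `g(z + 2) = g(z)` on `ℍ` is `2`-periodic in
Mathlib's sense (`Periodic (f ∘ ofComplex) 2`). [folklore] -/
theorem periodic_comp_ofComplex_two (hp : ∀ z : ℂ, 0 < z.im → g (z + 2) = g z) :
    Periodic ((fun τ : ℍ ↦ g τ) ∘ ofComplex) (2 : ℝ) := by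
  intro w
  by_cases hw : 0 < im w
  · have hw' : 0 < im (w + (2 : ℝ)) := by simpa using hw
    rw [comp_ofComplex_of_im_pos _ _ hw', comp_ofComplex_of_im_pos _ _ hw]
    change g (w + (2 : ℝ)) = g w
    rw [show (w + (2 : ℝ) : ℂ) = w + 2 by push_cast; ring]
    exact hp w hw
  · have hw0 : im w ≤ 0 := not_lt.mp hw
    have hw' : im (w + (2 : ℝ)) ≤ 0 := by simpa using hw0
    exact comp_ofComplex_of_im_le_zero _ _ _ hw' hw0

/-- The restriction to `ℍ` of a function holomorphic on `ℍ` is `MDifferentiable`. [folklore] -/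
theorem mdifferentiable_of_differentiableAt
    (hd : ∀ z : ℂ, 0 < z.im → DifferentiableAt ℂ g z) : MDiff (fun τ : ℍ ↦ g τ) := by
  rw [UpperHalfPlane.mdifferentiable_iff]
  have h1 : DifferentiableOn ℂ g {z : ℂ | 0 < z.im} := fun z hz ↦ (hd z hz).differentiableWithinAt
  refine h1.congr fun z hz ↦ ?_
  simp [ofComplex_apply_of_im_pos hz]

/-- The restriction to `ℍ` of a function with a limit at `i∞` is bounded at `i∞`. [folklore] -/
theorem isBoundedAtImInfty_of_tendsto {c : ℂ} (hb : Tendsto g (comap im atTop) (𝓝 c)) :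
    IsBoundedAtImInfty (fun τ : ℍ ↦ g τ) :=
  (hb.comp tendsto_coe_atImInfty).isBigO_one ℝ

/-- The cusp function at period `2` of such a restriction is analytic at `0`. [folklore] -/
theorem analyticAt_cuspFunction_two (hp : ∀ z : ℂ, 0 < z.im → g (z + 2) = g z)
    (hd : ∀ z : ℂ, 0 < z.im → DifferentiableAt ℂ g z) {c : ℂ}
    (hb : Tendsto g (comap im atTop) (𝓝 c)) :
    AnalyticAt ℂ (cuspFunction 2 (fun τ : ℍ ↦ g τ)) 0 :=
  analyticAt_cuspFunction_zero two_pos (periodic_comp_ofComplex_two hp)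
    (mdifferentiable_of_differentiableAt hd) (isBoundedAtImInfty_of_tendsto hb)

/-- **`q`-expansion at period `2`.** A `2`-periodic function holomorphic on `ℍ` with a limit at
`i∞` is the sum of its `q`-expansion in `q = e^{πiτ}` (Mathlib's `hasSum_qExpansion`).
[folklore] -/
theorem hasSum_qExpansion_two (hp : ∀ z : ℂ, 0 < z.im → g (z + 2) = g z)
    (hd : ∀ z : ℂ, 0 < z.im → DifferentiableAt ℂ g z) {c : ℂ}
    (hb : Tendsto g (comap im atTop) (𝓝 c)) (τ : ℍ) :
    HasSum (fun m : ℕ ↦ (qExpansion 2 (fun τ : ℍ ↦ g τ)).coeff m * Periodic.qParam 2 τ ^ m)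
      (g τ) := by
  simpa only [smul_eq_mul] using hasSum_qExpansion two_pos (periodic_comp_ofComplex_two hp)
    (mdifferentiable_of_differentiableAt hd) (isBoundedAtImInfty_of_tendsto hb) τ

/-- If such a restriction is everywhere the sum of an explicit `q`-series `Σ aₘ qᵐ`, then its
`qExpansion 2` is `PowerSeries.mk a`. [folklore] -/
theorem qExpansion_two_eq_mk_of_hasSum (hp : ∀ z : ℂ, 0 < z.im → g (z + 2) = g z)
    (hd : ∀ z : ℂ, 0 < z.im → DifferentiableAt ℂ g z) {c : ℂ}
    (hb : Tendsto g (comap im atTop) (𝓝 c)) {a : ℕ → ℂ}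
    (ha : ∀ τ : ℍ, HasSum (fun m : ℕ ↦ a m * Periodic.qParam 2 τ ^ m) (g τ)) :
    qExpansion 2 (fun τ : ℍ ↦ g τ) = PowerSeries.mk a := by
  ext m
  rw [PowerSeries.coeff_mk]
  exact qExpansion_coeff_eq_of_hasSum two_pos (analyticAt_cuspFunction_two hp hd hb)
    (fun τ ↦ by simpa only [smul_eq_mul] using ha τ) m

/-- Powers: `qExpansion 2 (g ^ n) = (qExpansion 2 g) ^ n` for such restrictions. [folklore] -/
theorem qExpansion_two_pow (hp : ∀ z : ℂ, 0 < z.im → g (z + 2) = g z)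
    (hd : ∀ z : ℂ, 0 < z.im → DifferentiableAt ℂ g z) {c : ℂ}
    (hb : Tendsto g (comap im atTop) (𝓝 c)) (n : ℕ) :
    qExpansion 2 ((fun τ : ℍ ↦ g τ) ^ n) = qExpansion 2 (fun τ : ℍ ↦ g τ) ^ n ∧
      AnalyticAt ℂ (cuspFunction 2 ((fun τ : ℍ ↦ g τ) ^ n)) 0 := by
  have han := analyticAt_cuspFunction_two hp hd hb
  refine ⟨(qExpansion_pow han n).1, ?_⟩
  rw [(qExpansion_pow han n).2]
  exact han.pow n

end Restrict

/-! ### The theta series `θ₃ = 1 + 2q + 2q⁴ + ⋯` and `θ(τ/2, τ)/2 = 1 + q² + q⁶ + ⋯` -/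

/-- **`θ₃(τ) = Σₘ a(m) qᵐ`** (`q = e^{πiτ}`) with `a = 1, 2, 0, 0, 2, 0, …` the number of
`n ∈ ℤ` with `n² = m`; in particular `a ∈ ℤ`, `a(0) = 1`, `a(1) = 2`. [folklore] -/
theorem exists_hasSum_theta3_qParam_two :
    ∃ a : ℕ → ℤ, a 0 = 1 ∧ a 1 = 2 ∧
      ∀ τ : ℍ, HasSum (fun m : ℕ ↦ (a m : ℂ) * Periodic.qParam 2 τ ^ m) (theta3 τ) := by
  classical
  let a : ℕ → ℤ := fun m ↦ if m = 0 then 1 else if IsSquare m then 2 else 0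
  refine ⟨a, by simp [a], by simp [a], fun τ ↦ ?_⟩
  set q : ℂ := Periodic.qParam 2 τ with hq
  -- the terms `m ≥ 1`
  have h1 : HasSum (fun m : ℕ ↦ if m = 0 then (0 : ℂ) else (a m : ℂ) * q ^ m)
      (theta3 τ - 1) := by
    have hθ := (hasSum_nat_jacobiTheta τ.im_pos).mul_left 2
    rw [mul_div_cancel₀ _ (two_ne_zero' ℂ)] at hθ
    rw [show theta3 (τ : ℂ) = jacobiTheta τ from (jacobiTheta_eq_jacobiTheta₂ _).symm]
    have hinj : Function.Injective fun n : ℕ ↦ (n + 1) ^ 2 := fun a b h ↦ by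
      simpa using (Nat.pow_left_injective two_ne_zero h : a + 1 = b + 1)
    refine (Function.Injective.hasSum_iff hinj ?_).mp ?_
    · intro m hm
      simp only [Set.mem_range, not_exists] at hm
      by_cases hm0 : m = 0
      · simp [hm0]
      · have hns : ¬ IsSquare m := by
          rintro ⟨r, hr⟩
          rcases Nat.eq_zero_or_pos r with rfl | hr0
          · exact hm0 (by simpa using hr)
          · exact hm (r - 1) (by rw [Nat.sub_add_cancel hr0, sq, ← hr])
        simp [a, hm0, hns]
    · have heq : ((fun m : ℕ ↦ if m = 0 then (0 : ℂ) else (a m : ℂ) * q ^ m) ∘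
          fun n : ℕ ↦ (n + 1) ^ 2) =
          fun n : ℕ ↦ 2 * cexp (π * Complex.I * ((n : ℂ) + 1) ^ 2 * τ) := by
        funext n
        have hsq : IsSquare ((n + 1) ^ 2) := ⟨n + 1, sq _⟩
        have hne : (n + 1) ^ 2 ≠ 0 := by positivity
        simp only [Function.comp_apply, hne, if_false, a, hsq, if_true, Int.cast_ofNat]
        rw [hq, ← exp_pi_I_natCast_mul ((n + 1) ^ 2)]
        push_cast
        ring_nf
      rw [heq]
      have : theta3 (τ : ℂ) = jacobiTheta τ := (jacobiTheta_eq_jacobiTheta₂ _).symm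
      simpa only [this] using hθ
  -- the term `m = 0`
  have h0 : HasSum (fun m : ℕ ↦ if m = 0 then (1 : ℂ) else 0) 1 := hasSum_ite_eq 0 1
  convert h0.add h1 using 1
  · funext m
    by_cases hm : m = 0
    · simp [a, hm]
    · simp [hm]
  · ring

/-- **`θ(τ/2, τ)/2 = Σ_{n ≥ 0} q^{n(n+1)} = Σₘ c(m) qᵐ`** (`q = e^{πiτ}`;
`θ₂ = e^{πiτ/4} θ(τ/2, τ)`)
with `c(m) = 1` if `m = n(n+1)` for some `n ≥ 0` and `c(m) = 0` otherwise; in particular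
`c ∈ ℤ`, `c(0) = 1`, `c(1) = 0`. (Pair the terms `n` and `−1−n` of `Σ_{n∈ℤ} e^{πi(n²+n)τ}`.)
[folklore] -/
theorem exists_hasSum_jacobiTheta₂_half_qParam_two :
    ∃ c : ℕ → ℤ, c 0 = 1 ∧ c 1 = 0 ∧
      ∀ τ : ℍ, HasSum (fun m : ℕ ↦ (c m : ℂ) * Periodic.qParam 2 τ ^ m)
        (jacobiTheta₂ ((τ : ℂ) / 2) τ / 2) := by
  classical
  let c : ℕ → ℤ := fun m ↦ if ∃ n : ℕ, n * (n + 1) = m then 1 else 0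
  have hc0 : c 0 = 1 := by simp only [c]; rw [if_pos ⟨0, rfl⟩]
  have hc1 : c 1 = 0 := by
    simp only [c]
    rw [if_neg]
    rintro ⟨n, hn⟩
    rcases Nat.eq_zero_or_pos n with rfl | hn0
    · simp at hn
    · have : 1 * 2 ≤ n * (n + 1) := Nat.mul_le_mul hn0 (by omega)
      omega
  refine ⟨c, hc0, hc1, fun τ ↦ ?_⟩
  set q : ℂ := Periodic.qParam 2 τ with hq
  have hterm : ∀ n : ℕ,
      jacobiTheta₂_term (n : ℤ) ((τ : ℂ) / 2) τ = q ^ (n * (n + 1)) ∧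
        jacobiTheta₂_term (-((n : ℤ) + 1)) ((τ : ℂ) / 2) τ = q ^ (n * (n + 1)) := by
    intro n
    constructor
    · rw [jacobiTheta₂_term, hq, ← exp_pi_I_natCast_mul]
      congr 1
      push_cast
      ring
    · rw [jacobiTheta₂_term, hq, ← exp_pi_I_natCast_mul]
      congr 1
      push_cast
      ring
  -- pair `n` with `-(n+1)`
  have h2 := (hasSum_jacobiTheta₂_term ((τ : ℂ) / 2) τ.im_pos).nat_add_neg_add_one
  have h3 : HasSum (fun n : ℕ ↦ 2 * q ^ (n * (n + 1))) (jacobiTheta₂ ((τ : ℂ) / 2) τ) := by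
    convert h2 using 1
    funext n
    rw [(hterm n).1, (hterm n).2, two_mul]
  have h4 : HasSum (fun n : ℕ ↦ q ^ (n * (n + 1))) (jacobiTheta₂ ((τ : ℂ) / 2) τ / 2) := by
    have := h3.div_const 2
    simpa only [mul_div_cancel_left₀ _ (two_ne_zero' ℂ)] using this
  -- reindex along the injective map `n ↦ n (n + 1)`
  have hinj : Function.Injective fun n : ℕ ↦ n * (n + 1) :=
    StrictMono.injective fun a b hab ↦ Nat.mul_lt_mul'' hab (Nat.succ_lt_succ hab)
  refine (Function.Injective.hasSum_iff hinj ?_).mp ?_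
  · intro m hm
    rw [Set.mem_range] at hm
    simp only [c, if_neg hm, Int.cast_zero, zero_mul]
  · convert h4 using 1
    funext n
    simp only [Function.comp_apply, c]
    rw [if_pos ⟨n, rfl⟩]
    push_cast
    ring

/-- `θ₂(z)⁴/16 = e^{πiz} · (θ(z/2, z)/2)⁴` for every `z : ℂ` (`θ₂ = e^{πiz/4} θ(z/2, z)`).
[folklore] -/
theorem theta2_pow_four_div_sixteen (z : ℂ) :
    theta2 z ^ 4 / 16 = cexp (π * I * z) * (jacobiTheta₂ (z / 2) z / 2) ^ 4 := by
  have h4 : cexp (π * I * z / 4) ^ 4 = cexp (π * I * z) := by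
    rw [← Complex.exp_nat_mul]
    congr 1
    push_cast
    ring
  rw [theta2, mul_pow, h4]
  ring

/-- `(λ(τ)/16) · θ₃(τ)⁴ = θ₂(τ)⁴/16` on `ℍ`. [folklore] -/
theorem modularLambda_div_sixteen_mul_theta3_pow_four {τ : ℂ} (hτ : 0 < im τ) :
    modularLambda τ / 16 * theta3 τ ^ 4 = theta2 τ ^ 4 / 16 := by
  have h3 : theta3 τ ≠ 0 := theta3_ne_zero hτ
  rw [modularLambda]
  field_simp

/-! ### The four `q`-expansions -/

/-- Hypotheses (P) `2`-periodicity, (D) holomorphy on `ℍ`, (B) limit at `i∞`, for `λ/16`.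
[folklore] -/
private theorem lambda16_hyp :
    (∀ z : ℂ, 0 < z.im → modularLambda (z + 2) / 16 = modularLambda z / 16) ∧
    (∀ z : ℂ, 0 < z.im → DifferentiableAt ℂ (fun z ↦ modularLambda z / 16) z) ∧
    Tendsto (fun z ↦ modularLambda z / 16) (comap im atTop) (𝓝 (0 / 16)) :=
  ⟨fun z _ ↦ by rw [modularLambda_add_two],
    fun _ hz ↦ (differentiableAt_modularLambda hz).div_const 16,
    tendsto_modularLambda.div_const 16⟩

/-- Hypotheses (P) `2`-periodicity, (D) holomorphy on `ℍ`, (B) limit at `i∞`, for `θ₃`.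
[folklore] -/
private theorem theta3_hyp :
    (∀ z : ℂ, 0 < z.im → theta3 (z + 2) = theta3 z) ∧
    (∀ z : ℂ, 0 < z.im → DifferentiableAt ℂ theta3 z) ∧
    Tendsto theta3 (comap im atTop) (𝓝 1) :=
  ⟨fun z _ ↦ by rw [show z + 2 = z + 1 + 1 by ring, theta3_add_one, theta4_add_one],
    fun _ hz ↦ differentiableAt_theta3 hz, tendsto_theta3⟩

/-- Hypotheses (P) `2`-periodicity, (D) holomorphy on `ℍ`, (B) limit at `i∞`, for `θ(z/2, z)/2`.
[folklore] -/
private theorem thetaHalf_hyp :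
    (∀ z : ℂ, 0 < z.im →
      jacobiTheta₂ ((z + 2) / 2) (z + 2) / 2 = jacobiTheta₂ (z / 2) z / 2) ∧
    (∀ z : ℂ, 0 < z.im → DifferentiableAt ℂ (fun z ↦ jacobiTheta₂ (z / 2) z / 2) z) ∧
    Tendsto (fun z ↦ jacobiTheta₂ (z / 2) z / 2) (comap im atTop) (𝓝 (2 / 2)) :=
  ⟨fun z _ ↦ by
      rw [show (z + 2) / 2 = z / 2 + 1 by ring, jacobiTheta₂_add_left, jacobiTheta₂_add_right],
    fun _ hz ↦ (differentiableAt_jacobiTheta₂_half hz).div_const 2,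
    tendsto_jacobiTheta₂_half.div_const 2⟩

/-- Hypotheses (P) `2`-periodicity, (D) holomorphy on `ℍ`, (B) limit at `i∞`, for `e^{πiz}`.
[folklore] -/
private theorem expPiI_hyp :
    (∀ z : ℂ, 0 < z.im → cexp (π * I * (z + 2)) = cexp (π * I * z)) ∧
    (∀ z : ℂ, 0 < z.im → DifferentiableAt ℂ (fun z ↦ cexp (π * I * z)) z) ∧
    Tendsto (fun z ↦ cexp (π * I * z)) (comap im atTop) (𝓝 (0 ^ 4)) := by
  refine ⟨fun z _ ↦ ?_, fun z _ ↦ by fun_prop, ?_⟩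
  · rw [mul_add, Complex.exp_add, show (π * I * 2 : ℂ) = 2 * π * I by ring, exp_two_pi_mul_I,
      mul_one]
  · refine (tendsto_exp_quarter.pow 4).congr fun z ↦ ?_
    rw [← Complex.exp_nat_mul]
    congr 1
    push_cast
    ring

/-- **`qExpansion 2 θ₃ = A ∈ ℤ⟦X⟧`** with `A = 1 + 2X + ⋯`. [folklore] -/
theorem exists_qExpansion_theta3_eq_map :
    ∃ A : PowerSeries ℤ, PowerSeries.constantCoeff A = 1 ∧ PowerSeries.coeff 1 A = 2 ∧
      qExpansion 2 (fun τ : ℍ ↦ theta3 τ) = A.map (Int.castRingHom ℂ) := by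
  obtain ⟨a, ha0, ha1, ha⟩ := exists_hasSum_theta3_qParam_two
  refine ⟨PowerSeries.mk a, by simp [PowerSeries.constantCoeff_mk, ha0],
    by simp [PowerSeries.coeff_mk, ha1], ?_⟩
  rw [qExpansion_two_eq_mk_of_hasSum theta3_hyp.1 theta3_hyp.2.1 theta3_hyp.2.2 ha]
  ext m
  simp [PowerSeries.coeff_mk, PowerSeries.coeff_map]

/-- **`qExpansion 2 (θ(τ/2,τ)/2) = C ∈ ℤ⟦X⟧`** with `C = 1 + 0·X + ⋯`. [folklore] -/
theorem exists_qExpansion_jacobiTheta₂_half_eq_map :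
    ∃ C : PowerSeries ℤ, PowerSeries.constantCoeff C = 1 ∧ PowerSeries.coeff 1 C = 0 ∧
      qExpansion 2 (fun τ : ℍ ↦ jacobiTheta₂ ((τ : ℂ) / 2) τ / 2) = C.map (Int.castRingHom ℂ) := by
  obtain ⟨c, hc0, hc1, hc⟩ := exists_hasSum_jacobiTheta₂_half_qParam_two
  refine ⟨PowerSeries.mk c, by simp [PowerSeries.constantCoeff_mk, hc0],
    by simp [PowerSeries.coeff_mk, hc1], ?_⟩
  rw [qExpansion_two_eq_mk_of_hasSum thetaHalf_hyp.1 thetaHalf_hyp.2.1 thetaHalf_hyp.2.2 hc]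
  ext m
  simp [PowerSeries.coeff_mk, PowerSeries.coeff_map]

/-- **`qExpansion 2 (e^{πiτ}) = X`.** [folklore] -/
theorem qExpansion_exp_pi_I : qExpansion 2 (fun τ : ℍ ↦ cexp (π * I * τ)) = PowerSeries.X := by
  classical
  have ha : ∀ τ : ℍ, HasSum (fun m : ℕ ↦ (if m = 1 then (1 : ℂ) else 0) * Periodic.qParam 2 τ ^ m)
      (cexp (π * I * τ)) := by
    intro τ
    rw [← qParam_two]
    convert hasSum_ite_eq 1 (Periodic.qParam 2 (τ : ℂ)) using 1
    funext m
    split_ifs with hm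
    · rw [hm, one_mul, pow_one]
    · rw [zero_mul]
  rw [qExpansion_two_eq_mk_of_hasSum expPiI_hyp.1 expPiI_hyp.2.1 expPiI_hyp.2.2 ha]
  ext m
  rw [PowerSeries.coeff_mk, PowerSeries.coeff_X]

/-! ### `λ/16 ∈ q + q²ℤ⟦q⟧` -/

/-- **The `q`-expansion of `λ/16` is an integer power series `X − 8X² + ⋯`.** There is
`L ∈ ℤ⟦X⟧` with `coeff 0 L = 0`, `coeff 1 L = 1`, `coeff 2 L = −8` and
`qExpansion 2 (λ/16) = L` in `ℂ⟦X⟧` (namely `L = X C⁴ A⁻⁴` with `A = qExpansion 2 θ₃`,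
`C = qExpansion 2 (θ(τ/2,τ)/2)`). [cite: CalegariDimitrovTang2025, §1 p. 3] -/
theorem exists_qExpansion_modularLambda_div_sixteen_eq_map :
    ∃ L : PowerSeries ℤ, PowerSeries.coeff 0 L = 0 ∧ PowerSeries.coeff 1 L = 1 ∧
      PowerSeries.coeff 2 L = -8 ∧
      qExpansion 2 (fun τ : ℍ ↦ modularLambda τ / 16) = L.map (Int.castRingHom ℂ) := by
  obtain ⟨A, hA0, hA1, hA⟩ := exists_qExpansion_theta3_eq_map
  obtain ⟨C, hC0, hC1, hC⟩ := exists_qExpansion_jacobiTheta₂_half_eq_map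
  set Lq := qExpansion 2 (fun τ : ℍ ↦ modularLambda τ / 16) with hLq
  -- the identity `Lq · A⁴ = X · C⁴` in `ℂ⟦X⟧`
  have hθ3pow := qExpansion_two_pow theta3_hyp.1 theta3_hyp.2.1 theta3_hyp.2.2 4
  have hHalfpow := qExpansion_two_pow thetaHalf_hyp.1 thetaHalf_hyp.2.1 thetaHalf_hyp.2.2 4
  have hkey : Lq * (A.map (Int.castRingHom ℂ)) ^ 4 =
      PowerSeries.X * (C.map (Int.castRingHom ℂ)) ^ 4 := by
    rw [← hA, ← hC, ← hθ3pow.1, ← hHalfpow.1, ← qExpansion_exp_pi_I, hLq,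
      ← qExpansion_mul (analyticAt_cuspFunction_two lambda16_hyp.1 lambda16_hyp.2.1
        lambda16_hyp.2.2) hθ3pow.2,
      ← qExpansion_mul (analyticAt_cuspFunction_two expPiI_hyp.1 expPiI_hyp.2.1
        expPiI_hyp.2.2) hHalfpow.2]
    congr 1
    funext τ
    simp only [Pi.mul_apply, Pi.pow_apply]
    rw [modularLambda_div_sixteen_mul_theta3_pow_four τ.im_pos, theta2_pow_four_div_sixteen]
  -- `A⁴` is a unit of `ℤ⟦X⟧`
  have hB : IsUnit (A ^ 4) := by
    rw [PowerSeries.isUnit_iff_constantCoeff, map_pow, hA0, one_pow]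
    exact isUnit_one
  set Binv : PowerSeries ℤ := ↑(hB.unit⁻¹) with hBinv
  have hBBinv : A ^ 4 * Binv = 1 := hB.mul_val_inv
  have hBinv0 : PowerSeries.constantCoeff Binv = 1 := by
    have := congr_arg PowerSeries.constantCoeff hBBinv
    rwa [map_mul, map_one, map_pow, hA0, one_pow, one_mul] at this
  have hA40 : PowerSeries.constantCoeff (A ^ 4) = 1 := by rw [map_pow, hA0, one_pow]
  have hBinv1 : PowerSeries.coeff 1 Binv = -8 := by
    have := congr_arg (PowerSeries.coeff 1) hBBinv
    rw [PowerSeries.coeff_one_mul, hBinv0, mul_one, hA40, mul_one, PowerSeries.coeff_one_pow,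
      hA1, hA0, one_pow, mul_one, show PowerSeries.coeff 1 (1 : PowerSeries ℤ) = 0 by simp] at this
    push_cast at this
    linarith
  refine ⟨PowerSeries.X * (C ^ 4 * Binv), PowerSeries.coeff_zero_X_mul _, ?_, ?_, ?_⟩
  · rw [show (1 : ℕ) = 0 + 1 from rfl, PowerSeries.coeff_succ_X_mul,
      PowerSeries.coeff_zero_eq_constantCoeff_apply, map_mul, map_pow, hC0, hBinv0]
    norm_num
  · rw [show (2 : ℕ) = 1 + 1 from rfl, PowerSeries.coeff_succ_X_mul, PowerSeries.coeff_one_mul,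
      PowerSeries.coeff_one_pow, hC1, hC0, hBinv0, hBinv1, map_pow, hC0]
    norm_num
  · -- cancel the unit `A⁴`
    have hu : IsUnit ((A.map (Int.castRingHom ℂ)) ^ 4) := by
      rw [← map_pow]
      exact hB.map _
    have h1 : (A.map (Int.castRingHom ℂ)) ^ 4 * Binv.map (Int.castRingHom ℂ) = 1 := by
      rw [← map_pow, ← map_mul, hBBinv, map_one]
    refine (hu.mul_left_inj).mp ?_
    rw [hkey]
    simp only [map_mul, map_pow, PowerSeries.map_X]
    linear_combination (-(PowerSeries.X * (C.map (Int.castRingHom ℂ)) ^ 4)) * h1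

/-- **`λ(τ)/16 = Σₘ (qExpansion 2 (λ/16))ₘ · e^{πimτ}`** for every `τ ∈ ℍ`. [folklore] -/
theorem hasSum_qExpansion_modularLambda_div_sixteen (τ : ℍ) :
    HasSum (fun m : ℕ ↦
        (qExpansion 2 (fun τ : ℍ ↦ modularLambda τ / 16)).coeff m * Periodic.qParam 2 τ ^ m)
      (modularLambda τ / 16) :=
  hasSum_qExpansion_two lambda16_hyp.1 lambda16_hyp.2.1 lambda16_hyp.2.2 τ

/-- **Calegari–Dimitrov–Tang's display `λ/16 = q − 8q² + ⋯ ∈ q + q²ℤ⟦q⟧`, `q = e^{πiτ}`.**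
There is an integer power series `L = X − 8X² + ⋯` (`coeff 0 L = 0`, `coeff 1 L = 1`,
`coeff 2 L = −8`) such that `λ(τ)/16 = Σₘ Lₘ e^{πimτ}` for every `τ` with `Im τ > 0`.
[cite: CalegariDimitrovTang2025, §1 p. 3] -/
theorem exists_hasSum_modularLambda_div_sixteen :
    ∃ L : PowerSeries ℤ, PowerSeries.coeff 0 L = 0 ∧ PowerSeries.coeff 1 L = 1 ∧
      PowerSeries.coeff 2 L = -8 ∧
      ∀ τ : ℂ, 0 < im τ →
        HasSum (fun m : ℕ ↦ ((PowerSeries.coeff m L : ℤ) : ℂ) * cexp (π * I * τ) ^ m)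
          (modularLambda τ / 16) := by
  obtain ⟨L, hL0, hL1, hL2, hL⟩ := exists_qExpansion_modularLambda_div_sixteen_eq_map
  refine ⟨L, hL0, hL1, hL2, fun τ hτ ↦ ?_⟩
  have h := hasSum_qExpansion_modularLambda_div_sixteen ⟨τ, hτ⟩
  rw [hL] at h
  simpa only [PowerSeries.coeff_map, eq_intCast, coe_mk, qParam_two] using h

end ModularLambda

end Literature.NumberTheory.Automorphic

end
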